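import Summits.Parity.GeneralizedHardyLittlewood.Theorems.LeeYangFibresRelativeDimOneMoebiusSplitDefs
import Mathlib
import HarnessLib

/-!
# Route `LeeYangFibres`, crux `RelativeDimOne` (stmt-Parity-14113), line `single-moebius-split`,
# stub `stub_tssCompose` (T1b-C) — auxiliary file 3: the staggered levels `R_i = N^{δ_i}`

Elementary facts about the levels `R_i = N^{δ_i}` of the truncated divisor sums, for exponents
`δ_i > 0` with `2 ∑_{j>i} δ_j ≤ δ_i` (`StaggeredBy 2 δ`) and `∑ δ_i ≤ 1/4`, in the integer parameter
`N → ∞` — the level hypotheses of the general-data induction `TSSInduction` and the final size of its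
error term:

* `tssC_log_pow_mul_exp_neg_sqrt_le` — `(log N)^p exp(−c √(η log N)) ≤ ε` eventually (the
  Goldston–Yıldırım / de la Vallée Poussin saving beats every power of `log N`);
* `tssC_last_le`, `tssC_le_one` — the last exponent is the smallest, every exponent is `≤ 1`;
* `tssC_levels` — the registered sub-goal: for `N ≥ N₀(k, δ, …)` one has `Rmin := N^{δ_k} ≥ 8`,
  `Rmin ≤ R_i ≤ N`, `⌊R_i⌋ ≤ N`, the staggering `C_P (∏_{j>i} R_j)³ ≤ R_i²` against any constant
  `C_P` (as `3 ∑_{j>i} δ_j ≤ (3/2) δ_i` and `C_P ≤ N^{δ_k/2}`), and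
  `K (log N)^{m+k+1} e^{−c√(log Rmin)} ≤ ε`.

References: D. A. Goldston, C. Y. Yıldırım, Integers 3 (2003) A5 = arXiv:math/0111212, §3
[GoldstonYildirim2001]; H. Iwaniec, E. Kowalski, *Analytic Number Theory* (2004), §5.6 [IwaniecKowalski2004].
-/

noncomputable section

open scoped BigOperators
open Filter Finset

namespace Summit.Parity.GeneralizedHardyLittlewood.Cruxes.RelativeDimOne.SingleMoebiusSplit

/-! ### The `exp(−c√log)` saving beats log-powers -/

/-- **The `exp(−c√log)` saving beats log-powers**: for `c, η, ε > 0` and `p ∈ ℕ`,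
`(log N)^p · exp(−c √(η log N)) ≤ ε` for all large `N`. [folklore] -/
theorem tssC_log_pow_mul_exp_neg_sqrt_le (p : ℕ) {c η ε : ℝ} (hc : 0 < c) (hη : 0 < η) (hε : 0 < ε) :
    ∀ᶠ N : ℕ in Filter.atTop,
      Real.log N ^ p * Real.exp (-(c * Real.sqrt (η * Real.log N))) ≤ ε := by
  -- adapted from the lead folder's `eventually_log_pow_mul_exp_neg_sqrt_le` (stub_moebiusTermBV_aux8)
  -- `g(u) = (u²/η)^p e^{-cu} → 0`
  have hg : Tendsto (fun u : ℝ => (u ^ 2 / η) ^ p * Real.exp (-c * u)) atTop (nhds 0) := by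
    have h1 := tendsto_rpow_mul_exp_neg_mul_atTop_nhds_zero (2 * p) c hc
    have h2 : Tendsto (fun u : ℝ => (η ^ p)⁻¹ * (u ^ (2 * (p : ℝ)) * Real.exp (-c * u))) atTop
        (nhds 0) := by
      simpa using h1.const_mul ((η ^ p)⁻¹)
    refine h2.congr' ?_
    filter_upwards [eventually_ge_atTop (0 : ℝ)] with u hu
    have : u ^ (2 * (p : ℝ)) = (u ^ 2) ^ p := by
      rw [Real.rpow_mul hu, Real.rpow_natCast, Real.rpow_two]
    rw [this, div_pow]
    field_simp
  -- `u(N) = √(η log N) → ∞`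
  have hu : Tendsto (fun N : ℕ => Real.sqrt (η * Real.log N)) atTop atTop := by
    refine Real.tendsto_sqrt_atTop.comp ?_
    exact (Real.tendsto_log_atTop.comp tendsto_natCast_atTop_atTop).const_mul_atTop hη
  have hcomp := hg.comp hu
  have hev : ∀ᶠ N : ℕ in atTop, (fun u : ℝ => (u ^ 2 / η) ^ p * Real.exp (-c * u))
      (Real.sqrt (η * Real.log N)) ≤ ε := hcomp.eventually (eventually_le_nhds hε)
  filter_upwards [hev, eventually_ge_atTop 1] with N hN hN1
  have hlog : 0 ≤ Real.log N := Real.log_natCast_nonneg N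
  have hsq : Real.sqrt (η * Real.log N) ^ 2 / η = Real.log N := by
    rw [Real.sq_sqrt (mul_nonneg hη.le hlog)]
    field_simp
  simpa only [hsq, neg_mul] using hN

/-! ### Staggered exponents -/

/-- Under `StaggeredBy 2 δ` with positive exponents the LAST exponent is the smallest:
`δ_k ≤ ∑_{j>i} δ_j ≤ 2 ∑_{j>i} δ_j ≤ δ_i` for `i < k`. [folklore] -/
theorem tssC_last_le {k : ℕ} {δ : Fin (k + 1) → ℝ} (hδ : ∀ i, 0 < δ i) (hst : StaggeredBy 2 δ)
    (i : Fin (k + 1)) : δ (Fin.last k) ≤ δ i := by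
  by_cases hi : i = Fin.last k
  · rw [hi]
  · have hlt : i < Fin.last k := Fin.lt_last_iff_ne_last.mpr hi
    have h1 : δ (Fin.last k) ≤ ∑ j ∈ Finset.Ioi i, δ j :=
      Finset.single_le_sum (f := δ) (fun j _ => (hδ j).le) (Finset.mem_Ioi.mpr hlt)
    have h2 := hst i
    have h3 : 0 ≤ ∑ j ∈ Finset.Ioi i, δ j := Finset.sum_nonneg fun j _ => (hδ j).le
    linarith

/-- Positive exponents of total `≤ 1/4` are each `≤ 1`. [folklore] -/
theorem tssC_le_one {k : ℕ} {δ : Fin (k + 1) → ℝ} (hδ : ∀ i, 0 < δ i) (hsum : (∑ i, δ i) ≤ 1 / 4)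
    (i : Fin (k + 1)) : δ i ≤ 1 :=
  (Finset.single_le_sum (f := δ) (fun j _ => (hδ j).le) (Finset.mem_univ i)).trans
    (hsum.trans (by norm_num))

/-! ### The registered sub-goal: the levels -/

/-- **T1b-C, levels step** (registered sub-goal `tssC_levels` for `stub_tssCompose`). For exponents
`δ_i > 0`, `2∑_{j>i} δ_j ≤ δ_i`, `∑ δ_i ≤ 1/4`, any threshold `N₁`, any exponent `m`, any constants
`C_P`, `K ≥ 0`, `c > 0` and `ε > 0`, for all `N ≥ N₀`: `N ≥ N₁`, `N ≥ 3`, the smallest level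
`Rmin = N^{δ_k}` is `≥ 8`, `Rmin ≤ R_i = N^{δ_i} ≤ N`, `⌊R_i⌋ ≤ N`, the levels are staggered against
`C_P` — `C_P (∏_{j>i} R_j)³ ≤ R_i²`, since `C_P ≤ N^{δ_k/2}` and `δ_k/2 + 3∑_{j>i} δ_j ≤ 2δ_i` — and the
error of the induction is small: `K (log N)^{m+k+1} e^{−c√(log Rmin)} ≤ ε`. -/
theorem tssC_levels : ∀ (k : ℕ) (δ : Fin (k + 1) → ℝ), (∀ i, 0 < δ i) → StaggeredBy 2 δ →
    (∑ i, δ i) ≤ 1 / 4 → ∀ (N₁ m : ℕ) (CP K c ε : ℝ), 0 < c → 0 < ε → 0 ≤ K →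
    ∃ N₀ : ℕ, ∀ N : ℕ, N₀ ≤ N →
      N₁ ≤ N ∧ 3 ≤ N ∧ 8 ≤ (N : ℝ) ^ δ (Fin.last k) ∧
      (∀ i, (N : ℝ) ^ δ (Fin.last k) ≤ (N : ℝ) ^ δ i ∧ (N : ℝ) ^ δ i ≤ N) ∧
      (∀ i, ⌊(N : ℝ) ^ δ i⌋₊ ≤ N) ∧
      (∀ i : Fin (k + 1), CP * (∏ j ∈ Finset.Ioi i, (N : ℝ) ^ δ j) ^ 3 ≤ ((N : ℝ) ^ δ i) ^ 2) ∧
      K * Real.log N ^ (m + (k + 1)) *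
          Real.exp (-(c * Real.sqrt (Real.log ((N : ℝ) ^ δ (Fin.last k))))) ≤ ε := by
  intro k δ hδ hst hsum N₁ m CP K c ε hc hε hK
  have hη0 : 0 < δ (Fin.last k) := hδ _
  have hηle : ∀ i, δ (Fin.last k) ≤ δ i := tssC_last_le hδ hst
  have hδ1 : ∀ i, δ i ≤ 1 := tssC_le_one hδ hsum
  have hK1 : 0 < K + 1 := by linarith
  -- the eventualities in `N`
  have e1 : ∀ᶠ N : ℕ in atTop, (8 : ℝ) ≤ (N : ℝ) ^ δ (Fin.last k) :=
    ((tendsto_rpow_atTop hη0).comp (tendsto_natCast_atTop_atTop (R := ℝ))).eventually_ge_atTop 8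
  have e2 : ∀ᶠ N : ℕ in atTop, CP ≤ (N : ℝ) ^ (δ (Fin.last k) / 2) :=
    ((tendsto_rpow_atTop (half_pos hη0)).comp
      (tendsto_natCast_atTop_atTop (R := ℝ))).eventually_ge_atTop CP
  have e3 : ∀ᶠ N : ℕ in atTop, Real.log N ^ (m + (k + 1)) *
      Real.exp (-(c * Real.sqrt (δ (Fin.last k) * Real.log N))) ≤ ε / (K + 1) :=
    tssC_log_pow_mul_exp_neg_sqrt_le (m + (k + 1)) hc hη0 (div_pos hε hK1)
  obtain ⟨N₀, hN₀⟩ := Filter.eventually_atTop.mp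
    (e1.and (e2.and (e3.and ((eventually_ge_atTop N₁).and (eventually_ge_atTop 3)))))
  refine ⟨N₀, fun N hN => ?_⟩
  obtain ⟨h8, hCP, hgrowth, hN₁, hN3⟩ := hN₀ N hN
  have hN1 : (1 : ℝ) ≤ N := by exact_mod_cast le_trans (by norm_num) hN3
  have hN0 : (0 : ℝ) < N := by linarith
  have hRle : ∀ i, (N : ℝ) ^ δ i ≤ N := fun i =>
    (Real.rpow_le_rpow_of_exponent_le hN1 (hδ1 i)).trans_eq (Real.rpow_one _)
  refine ⟨hN₁, hN3, h8, fun i => ⟨Real.rpow_le_rpow_of_exponent_le hN1 (hηle i), hRle i⟩,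
    fun i => ?_, fun i => ?_, ?_⟩
  · -- `⌊R_i⌋ ≤ N`
    have h := Nat.floor_le_floor (hRle i)
    rwa [Nat.floor_natCast] at h
  · -- the staggering against `C_P`
    have hσ := hst i
    have hX0 : 0 ≤ (N : ℝ) ^ ((∑ j ∈ Finset.Ioi i, δ j) * ((3 : ℕ) : ℝ)) := by positivity
    rw [← Real.rpow_sum_of_pos hN0 δ (Finset.Ioi i), ← Real.rpow_mul_natCast hN0.le,
      ← Real.rpow_mul_natCast hN0.le]
    calc CP * (N : ℝ) ^ ((∑ j ∈ Finset.Ioi i, δ j) * ((3 : ℕ) : ℝ))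
        ≤ (N : ℝ) ^ (δ (Fin.last k) / 2) * (N : ℝ) ^ ((∑ j ∈ Finset.Ioi i, δ j) * ((3 : ℕ) : ℝ)) :=
          mul_le_mul_of_nonneg_right hCP hX0
      _ = (N : ℝ) ^ (δ (Fin.last k) / 2 + (∑ j ∈ Finset.Ioi i, δ j) * ((3 : ℕ) : ℝ)) :=
          (Real.rpow_add hN0 _ _).symm
      _ ≤ (N : ℝ) ^ (δ i * ((2 : ℕ) : ℝ)) := by
          refine Real.rpow_le_rpow_of_exponent_le hN1 ?_
          push_cast
          linarith [hηle i]
  · -- the size of the error term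
    rw [Real.log_rpow hN0]
    calc K * Real.log N ^ (m + (k + 1)) *
          Real.exp (-(c * Real.sqrt (δ (Fin.last k) * Real.log N)))
        = K * (Real.log N ^ (m + (k + 1)) *
            Real.exp (-(c * Real.sqrt (δ (Fin.last k) * Real.log N)))) := by ring
      _ ≤ K * (ε / (K + 1)) := mul_le_mul_of_nonneg_left hgrowth hK
      _ ≤ ε := by
          rw [mul_div_assoc', div_le_iff₀ hK1]
          nlinarith

end Summit.Parity.GeneralizedHardyLittlewood.Cruxes.RelativeDimOne.SingleMoebiusSplit
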